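import Summits.AtomisticToContinuum.Crystallization.Theorems.FrustratedLawDichotomyExemptMove
import Summits.AtomisticToContinuum.Crystallization.Theorems.FrustratedLawDichotomyFarFieldSharp

/-!
# FrustratedLawDichotomy · crux `AperiodicFrustratedLawGap` (stmt-AtomisticToContinuum-27623) — MOTIF-LOCAL EXEMPTION TESTS WITH THE
# SHARP FAR-FIELD CONSTANT `T♯(D)` (decomp-a2c, prover hand 2, structural share, generation 15; generic, radius-free)

`…ExemptLocal.exchangeUnstable_of_loc` / `…ExemptMove.exchangeUnstable_one_of_localMove` turn a MOTIF-LOCAL exchange / one-atom-move gain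
(fields summed over the atoms within `Rm ≥ ϱ + D` of the site) into the cluster-level exemption `ExchangeUnstable ε ϱ K` at the slack
`ε + 2K·T(D)`, `T(D) = tailConst D ≈ 2612/D³` — `T(D) ≤ 10⁻³` needs `D ≥ 138` (hand-1 g14 caveat; critic row 543 (B1): «a sharpened far-field
constant is a KNOWN-type item»).  This file re-instantiates the chain with the SHARP constant of `…FarFieldSharp.abs_tsum_field_le_of_far_sharp`:

* `tailConstSharp D = 4000/(1029 D³) + 500/(49 D⁴) + 2/(7 D⁵) + 1/(3 D⁶)` (`D ≥ 1`; `T♯(10) ≤ 1/200`, `T♯(20) ≤ 11/20000`, and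
  `T♯(D) ≤ 15/D³ ≤ T(D)` for `D ≥ 1` — every sharp statement implies the crude one);
* `abs_tsum_field_le_sharp` / `abs_fieldEnergy_far_le_sharp` — `|Σ'_{y ∈ Y} V_LJ(dist z y)| ≤ T♯(D)`, `|I(x, Y)| ≤ #x·T♯(D)` for a
  `7/10`-separated `Y` at distance `≥ D ≥ 1` from the points;
* ★ `exchangeUnstable_of_loc_sharp` : `ϱ + D ≤ Rm → 1 ≤ D → ExchangeUnstableLoc (ε + 2K·T♯(D)) ϱ Rm K ⟹ ExchangeUnstable ε ϱ K`;
  `deepAbsent_exchangeUnstableLoc_sharp`; ★ `exchangeUnstable_one_of_localMove_sharp` (local one-atom-move gain `> ε + 2·T♯(D)` ⟹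
  `ExchangeUnstable ε ϱ 1`); BY NAME `aperiodicFrustratedLawGap_of_exchangeLocExempt_sharp`, `…_of_schurCut_exchangeLoc_sharp_fourHalf`.

NUMBERS for the census / lens-5 (O4′): slack `2·T♯(D)` = `9.8·10⁻³ (D = 10)`, `2.7·10⁻³ (15)`, `1.1·10⁻³ (20)`, `3.1·10⁻⁴ (30)`; the tree's
`2·T(D)` reaches `10⁻³` only at `D ≈ 174`.  (For one-atom moves of small step the DIPOLE slack of `…ExemptMoveDipole` is sharper still.)
All `[folklore]` bookkeeping on landed lemmas.
-/

noncomputable section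

namespace Summit.AtomisticToContinuum.Crystallization.Theorems.FrustratedLawDichotomyExemptLocalSharp

open Metric
open scoped BigOperators
open Literature.MathematicalPhysics.StatisticalMechanics
open Summit.AtomisticToContinuum.Crystallization.Theorems.FrustratedLawDichotomyExemptDoor
open Summit.AtomisticToContinuum.Crystallization.Theorems.FrustratedLawDichotomyExemptRemoval
  (tailConst SchurRangeGapX aperiodicFrustratedLawGap_of_schurCutX_fourHalf)
open Summit.AtomisticToContinuum.Crystallization.Theorems.FrustratedLawDichotomyExemptLocOpt
  (ExchangeUnstable locOptDepth deepAbsent_exchangeUnstable tsum_sdiff_split)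
open Summit.AtomisticToContinuum.Crystallization.Theorems.FrustratedLawDichotomyExemptLocal
  (ExchangeUnstableLoc summable_range sep_range)
open Summit.AtomisticToContinuum.Crystallization.Theorems.FrustratedLawDichotomyExemptMove (exchangeUnstableLoc_one_of_move)
open Summit.AtomisticToContinuum.Crystallization.Theorems.FrustratedLawDichotomyFarFieldSharp
  (abs_tsum_field_le_of_far_sharp_sevenTenths)
open Summit.AtomisticToContinuum.Crystallization.Theorems.FrustratedLawDichotomyRangeCut (Sep PeriodicEnergyCeiling)
open Summit.AtomisticToContinuum.Crystallization.Theorems.FrustratedLawDichotomySchurCut (w₄₅ ω₄ SF₄₅)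

/-! ## §1. The sharp far-field constant at separation `7/10` -/

/-- **The SHARP far-field constant `T♯(D)`** of a `7/10`-separated set beyond distance `D ≥ 1` (`…FarFieldSharp.abs_tsum_field_le_of_far_sharp`,
`δ = 7/10`, `|V_LJ| ≤ r⁻⁶/6`): `4000/(1029 D³) + 500/(49 D⁴) + 2/(7 D⁵) + 1/(3 D⁶)`. -/
def tailConstSharp (D : ℝ) : ℝ := 4000 / 1029 * D⁻¹ ^ 3 + 500 / 49 * D⁻¹ ^ 4 + 2 / 7 * D⁻¹ ^ 5 + 1 / 3 * D⁻¹ ^ 6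

/-- `T♯(D) ≥ 0` for `D ≥ 0`. [folklore] -/
theorem tailConstSharp_nonneg {D : ℝ} (hD : 0 ≤ D) : 0 ≤ tailConstSharp D := by
  unfold tailConstSharp; positivity

/-- `T♯` is antitone on `(0, ∞)`. [folklore] -/
theorem tailConstSharp_anti {D D' : ℝ} (hD : 0 < D) (h : D ≤ D') : tailConstSharp D' ≤ tailConstSharp D := by
  have hi : D'⁻¹ ≤ D⁻¹ := (inv_le_inv₀ (hD.trans_le h) hD).2 h
  have hi0 : 0 ≤ D'⁻¹ := inv_nonneg.2 (hD.le.trans h)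
  unfold tailConstSharp
  gcongr

/-- **One-term form**: `T♯(D) ≤ 15/D³` for `D ≥ 1`. [folklore] -/
theorem tailConstSharp_le_div_cube {D : ℝ} (hD : 1 ≤ D) : tailConstSharp D ≤ 15 * D⁻¹ ^ 3 := by
  have h0 : 0 ≤ D⁻¹ := inv_nonneg.2 (by linarith)
  have h1 : D⁻¹ ≤ 1 := inv_le_one_of_one_le₀ hD
  have h3 : 0 ≤ D⁻¹ ^ 3 := pow_nonneg h0 3
  have h4 : D⁻¹ ^ 4 ≤ D⁻¹ ^ 3 := pow_le_pow_of_le_one h0 h1 (by norm_num)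
  have h5 : D⁻¹ ^ 5 ≤ D⁻¹ ^ 3 := pow_le_pow_of_le_one h0 h1 (by norm_num)
  have h6 : D⁻¹ ^ 6 ≤ D⁻¹ ^ 3 := pow_le_pow_of_le_one h0 h1 (by norm_num)
  unfold tailConstSharp
  linarith

/-- **The sharp constant implies the crude one**: `T♯(D) ≤ T(D)` for `D ≥ 1` (`T(D) = tailConst D ≈ 2612/D³`). [folklore] -/
theorem tailConstSharp_le_tailConst {D : ℝ} (hD : 1 ≤ D) : tailConstSharp D ≤ tailConst D := by
  refine (tailConstSharp_le_div_cube hD).trans ?_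
  have h3 : 0 ≤ D⁻¹ ^ 3 := by positivity
  have hT : tailConst D = ((7 / 10 : ℝ)⁻¹ ^ 6 / 12 + 1 / 6) * (1024 / (7 / 10 : ℝ) ^ 3) * D⁻¹ ^ 3 := by
    unfold tailConst; rw [inv_pow]; field_simp
  rw [hT]
  exact mul_le_mul_of_nonneg_right (by norm_num) h3

/-- `T♯(10) ≤ 1/200`. [folklore] -/
theorem tailConstSharp_ten_le : tailConstSharp 10 ≤ 1 / 200 := by
  unfold tailConstSharp; norm_num

/-- `T♯(20) ≤ 11/20000`. [folklore] -/
theorem tailConstSharp_twenty_le : tailConstSharp 20 ≤ 11 / 20000 := by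
  unfold tailConstSharp; norm_num

/-! ## §2. Sharp far-field bounds for `7/10`-separated sets -/

/-- **Sharp far field**: if `Y ⊆ ℝ³` is `7/10`-separated and every point of `Y` is at distance `≥ D ≥ 1` from `z`, then
`|Σ'_{y ∈ Y} V_LJ(dist z y)| ≤ T♯(D)`. [folklore] -/
theorem abs_tsum_field_le_sharp {Y : Set (EuclideanSpace ℝ (Fin 3))}
    (hsepY : ∀ a ∈ Y, ∀ b ∈ Y, a ≠ b → (7 : ℝ) / 10 ≤ dist a b) (z : EuclideanSpace ℝ (Fin 3)) {D : ℝ} (hD : 1 ≤ D)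
    (hfar : ∀ y ∈ Y, D ≤ dist z y) : |∑' y : ↥Y, lennardJones (dist z y)| ≤ tailConstSharp D :=
  abs_tsum_field_le_of_far_sharp_sevenTenths hsepY z hD hfar

/-- **Sharp far-field bound for a finite configuration**: `|I(x, Y)| ≤ #x·T♯(D)` when every point of `x` is at distance `≥ D ≥ 1` from every atom
of the `7/10`-separated `Y`. [folklore] -/
theorem abs_fieldEnergy_far_le_sharp {Y : Set (EuclideanSpace ℝ (Fin 3))}
    (hsepY : ∀ a ∈ Y, ∀ b ∈ Y, a ≠ b → (7 : ℝ) / 10 ≤ dist a b) {D : ℝ} (hD : 1 ≤ D)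
    {a : ℕ} (x : Fin a → EuclideanSpace ℝ (Fin 3)) (hx : ∀ i, ∀ y ∈ Y, D ≤ dist (x i) y) :
    |∑ i, ∑' y : ↥Y, lennardJones (dist (x i) y)| ≤ a * tailConstSharp D := by
  calc |∑ i, ∑' y : ↥Y, lennardJones (dist (x i) y)| ≤ ∑ i, |∑' y : ↥Y, lennardJones (dist (x i) y)| :=
        Finset.abs_sum_le_sum_abs _ _
    _ ≤ ∑ _i : Fin a, tailConstSharp D := Finset.sum_le_sum fun i _ => abs_tsum_field_le_sharp hsepY (x i) hD (hx i)
    _ = a * tailConstSharp D := by simp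

/-! ## §3. The motif-local exchange test with the sharp slack -/

/-- ★ **The local test implies the cluster-level exemption, sharp slack**: for `Rm ≥ ϱ + D`, `D ≥ 1`,
`ExchangeUnstableLoc (ε + 2K·T♯(D)) ϱ Rm K ⟹ ExchangeUnstable ε ϱ K` — the atoms of `y` beyond `Rm` from `y_j` are farther than `D` from the
ball and change each of the two fields by at most `K·T♯(D)`. [folklore] -/
theorem exchangeUnstable_of_loc_sharp {ε ϱ Rm D : ℝ} {K : ℕ} (hRm : ϱ + D ≤ Rm) (hD : (1 : ℝ) ≤ D)
    {N : ℕ} {y : Fin N → EuclideanSpace ℝ (Fin 3)} {j : Fin N}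
    (h : ExchangeUnstableLoc (ε + 2 * K * tailConstSharp D) ϱ Rm K N y j) : ExchangeUnstable ε ϱ K N y j := by
  obtain ⟨hsep, a, s, R, haK, hs, hsY, hsball, hR, hRball, hdisj, hlt⟩ := h
  refine ⟨a, s, R, haK, hs, hsY, hsball, hR, hRball, hdisj, ?_⟩
  have hAX : Set.range y ∩ closedBall (y j) Rm ⊆ Set.range y := Set.inter_subset_left
  have hSA : Set.range s ⊆ Set.range y ∩ closedBall (y j) Rm := fun q hq => by
    obtain ⟨l, rfl⟩ := hq
    exact ⟨hsY ⟨l, rfl⟩, mem_closedBall.2 (by linarith [hsball l])⟩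
  have hsplit : ∀ (x : Fin a → EuclideanSpace ℝ (Fin 3)),
      (∑ i, ∑' q : ↥(Set.range y \ Set.range s), lennardJones (dist (x i) q)) =
        (∑ i, ∑' q : ↥((Set.range y ∩ closedBall (y j) Rm) \ Set.range s), lennardJones (dist (x i) q)) +
          ∑ i, ∑' q : ↥(Set.range y \ (Set.range y ∩ closedBall (y j) Rm)), lennardJones (dist (x i) q) := by
    intro x
    rw [← Finset.sum_add_distrib]
    exact Finset.sum_congr rfl fun i _ => tsum_sdiff_split (summable_range y) hAX hSA (x i)
  have hsepF : ∀ p ∈ Set.range y \ (Set.range y ∩ closedBall (y j) Rm),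
      ∀ q ∈ Set.range y \ (Set.range y ∩ closedBall (y j) Rm), p ≠ q → (7 : ℝ) / 10 ≤ dist p q :=
    fun p hp q hq hpq => sep_range hsep p hp.1 q hq.1 hpq
  have hfar : ∀ z : EuclideanSpace ℝ (Fin 3), dist z (y j) ≤ ϱ →
      ∀ q ∈ Set.range y \ (Set.range y ∩ closedBall (y j) Rm), D ≤ dist z q := by
    intro z hz q hq
    have hqR : Rm < dist q (y j) := by
      by_contra hle
      rw [not_lt] at hle
      exact hq.2 ⟨hq.1, mem_closedBall.2 hle⟩
    have htri : dist q (y j) ≤ dist z q + dist z (y j) := by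
      rw [dist_comm z q]; exact dist_triangle q z (y j)
    linarith
  have hfs := abs_fieldEnergy_far_le_sharp hsepF hD s fun i q hq => hfar (s i) (hsball i) q hq
  have hfR := abs_fieldEnergy_far_le_sharp hsepF hD R fun i q hq => hfar (R i) (hRball i) q hq
  have hfs' := neg_abs_le (∑ i, ∑' q : ↥(Set.range y \ (Set.range y ∩ closedBall (y j) Rm)), lennardJones (dist (s i) q))
  have hfR' := le_abs_self (∑ i, ∑' q : ↥(Set.range y \ (Set.range y ∩ closedBall (y j) Rm)), lennardJones (dist (R i) q))
  have ha : (a : ℝ) ≤ K := by exact_mod_cast haK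
  have hT0 : 0 ≤ tailConstSharp D := tailConstSharp_nonneg (by linarith)
  have haT : (a : ℝ) * tailConstSharp D ≤ K * tailConstSharp D := mul_le_mul_of_nonneg_right ha hT0
  rw [hsplit R, hsplit s]
  linarith

/-- **The motif-local exchange exemption (sharp slack) is deep-absent** at the depth `…ExemptLocOpt.locOptDepth ε ϱ K`. [folklore] -/
theorem deepAbsent_exchangeUnstableLoc_sharp {ε ϱ Rm D : ℝ} {K : ℕ} (hε : 0 < ε) (hRm : ϱ + D ≤ Rm) (hD : (1 : ℝ) ≤ D) :
    DeepAbsent (locOptDepth ε ϱ K) (ExchangeUnstableLoc (ε + 2 * K * tailConstSharp D) ϱ Rm K) :=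
  (deepAbsent_exchangeUnstable hε).of_imp fun _ _ _ h => exchangeUnstable_of_loc_sharp hRm hD h

/-- The sharp local test implies the crude one's conclusion at every `D ≥ 1`: `ExchangeUnstableLoc (ε + 2K·T♯(D)) ⟸ ExchangeUnstableLoc (ε + 2K·T(D))`
(the exemption predicate is antitone in the gain threshold). [folklore] -/
theorem exchangeUnstableLoc_sharp_of_crude {ε ϱ Rm D : ℝ} {K : ℕ} (hD : (1 : ℝ) ≤ D)
    {N : ℕ} {y : Fin N → EuclideanSpace ℝ (Fin 3)} {j : Fin N}
    (h : ExchangeUnstableLoc (ε + 2 * K * tailConst D) ϱ Rm K N y j) :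
    ExchangeUnstableLoc (ε + 2 * K * tailConstSharp D) ϱ Rm K N y j := by
  obtain ⟨hsep, a, s, R, haK, hs, hsY, hsball, hR, hRball, hdisj, hlt⟩ := h
  have hK : (0 : ℝ) ≤ 2 * K := by positivity
  have hle : 2 * (K : ℝ) * tailConstSharp D ≤ 2 * K * tailConst D :=
    mul_le_mul_of_nonneg_left (tailConstSharp_le_tailConst hD) hK
  exact ⟨hsep, a, s, R, haK, hs, hsY, hsball, hR, hRball, hdisj, by linarith⟩

/-! ## §4. The one-atom move certificate with the sharp slack -/

/-- ★ **LOCAL MOVE GAIN ⟹ CLUSTER-LEVEL EXEMPTION, sharp slack**: with `Rm ≥ ϱ + D`, `D ≥ 1`, a one-atom move inside `B̄(y_j, ϱ)` (step `< 7/10`)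
whose gain, computed from the atoms within `Rm` of `y_j` only, exceeds `ε + 2·T♯(D)` certifies `ExchangeUnstable ε ϱ 1 y j`. [folklore] -/
theorem exchangeUnstable_one_of_localMove_sharp {ε ϱ Rm D : ℝ} (hRm : ϱ + D ≤ Rm) (hD : (1 : ℝ) ≤ D)
    {N : ℕ} {y : Fin N → EuclideanSpace ℝ (Fin 3)} {j : Fin N}
    (hsep : Sep y) (hy : Function.Injective y) {p : EuclideanSpace ℝ (Fin 3)} (hpϱ : dist p (y j) ≤ ϱ)
    (hp7 : dist p (y j) < 7 / 10)
    (hgain : (∑ k ∈ (Finset.univ.erase j).filter (fun k => dist (y k) (y j) ≤ Rm), lennardJones (dist p (y k))) +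
        (ε + 2 * (1 : ℕ) * tailConstSharp D) <
      ∑ k ∈ (Finset.univ.erase j).filter (fun k => dist (y k) (y j) ≤ Rm), lennardJones (dist (y j) (y k))) :
    ExchangeUnstable ε ϱ 1 N y j :=
  exchangeUnstable_of_loc_sharp hRm hD (exchangeUnstableLoc_one_of_move hsep hy hpϱ hp7 hgain)

/-! ## §5. The crux BY NAME from a motif-local exempt price with the sharp slack -/

/-- **`AperiodicFrustratedLawGap` BY NAME**: `MuEquilibriumDoor ∧ ExemptFDG (ExchangeUnstableLoc (ε + 2K·T♯(D)) ϱ Rm K)` (`ε > 0`, `D ≥ 1`,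
`Rm ≥ ϱ + D`) `⟹` crux. [folklore] -/
theorem aperiodicFrustratedLawGap_of_exchangeLocExempt_sharp
    (hDoor : Summit.AtomisticToContinuum.Crystallization.Theses.GrainCoreNetworkSplit.MuEquilibriumDoor)
    {ε ϱ Rm D : ℝ} {K : ℕ} (hε : 0 < ε) (hRm : ϱ + D ≤ Rm) (hD : (1 : ℝ) ≤ D)
    (h : ExemptFDG (ExchangeUnstableLoc (ε + 2 * K * tailConstSharp D) ϱ Rm K)) :
    Summit.AtomisticToContinuum.Crystallization.Theses.FrustratedLawDichotomy.AperiodicFrustratedLawGap :=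
  aperiodicFrustratedLawGap_of_exemptFDG hDoor (deepAbsent_exchangeUnstableLoc_sharp hε hRm hD) h

/-- **Unsplit node of record with the sharp motif-local exchange exemption**: `MuEquilibriumDoor ∧ SF₄₅ ∧ UP(−0.7175) ∧
FRG♭_X(w₄₅, ω₄, 3/400; −0.7174, C, ExchangeUnstableLoc (ε + 2K·T♯(D)) ϱ Rm K) ⟹` crux (`ε > 0`, `D ≥ 1`, `Rm ≥ ϱ + D`). [folklore] -/
theorem aperiodicFrustratedLawGap_of_schurCut_exchangeLoc_sharp_fourHalf {ε ϱ Rm D C : ℝ} {K : ℕ}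
    (hDoor : Summit.AtomisticToContinuum.Crystallization.Theses.GrainCoreNetworkSplit.MuEquilibriumDoor)
    (hF : SF₄₅) (hU : PeriodicEnergyCeiling (-(7175 / 10000))) (hε : 0 < ε) (hRm : ϱ + D ≤ Rm) (hD : (1 : ℝ) ≤ D)
    (hG : SchurRangeGapX w₄₅ ω₄ (3 / 400) (-(7174 / 10000)) C (ExchangeUnstableLoc (ε + 2 * K * tailConstSharp D) ϱ Rm K)) :
    Summit.AtomisticToContinuum.Crystallization.Theses.FrustratedLawDichotomy.AperiodicFrustratedLawGap :=
  aperiodicFrustratedLawGap_of_schurCutX_fourHalf hDoor hF hU (deepAbsent_exchangeUnstableLoc_sharp hε hRm hD) hG (by norm_num)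

end Summit.AtomisticToContinuum.Crystallization.Theorems.FrustratedLawDichotomyExemptLocalSharp

end
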